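import Literature.NumberTheory.EllipticCurves.X1ElevenKummerValues
import Literature.NumberTheory.EllipticCurves.X1ElevenKummerDivisor
import Literature.NumberTheory.EllipticCurves.X1ElevenDescentGalois
import Literature.NumberTheory.EllipticCurves.X1ElevenNodeShift
import Literature.NumberTheory.EllipticCurves.IsogenyDescentWeilFunction
import Literature.NumberTheory.EllipticCurves.KubertTateEleven
import Literature.NumberTheory.EllipticCurves.MordellWeilTheoremProofs
import HarnessLib

/-!
# The `5`-descent on `X₁(11)`, V-b: `11A3(ℚ) = ℤ/5`, Billing–Mahler, and Mazur's theorem at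
# `N = 11`

Assembly of the explicit Eisenstein `5`-descent on `X₁(11) = 11A3 : y² + y = x³ - x²`
(B. Mazur, *Modular curves and the Eisenstein ideal*, Publ. Math. IHÉS 47 (1977), Ch. III §3 with
Intro. Thm. (7) and Ch. III §5 Cor. (5.3); overview in `X1ElevenKummerValues`):

1. `exists_eq_five_nsmul_add` — **`11A3(ℚ) ⊆ 5 · 11A3(ℚ) + ⟨T⟩`**, `T = (0,0)` of order `5`:
   the `μ₅`-side (`X1ElevenKummerValues`: `f_T(P) ∈ (ℚˣ)⁵`, and the Kummer form of the descent
   `IsogenyDescentWeilFunction.exists_stableCoset_of_kummer_eq_pow` with the divisor of `f_T`,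
   `X1ElevenKummerDivisor`) produces `R` with `5R = P` and `R + ⟨T̄⟩` `Γ_ℚ`-stable; the
   constant side (`X1ElevenDescentGalois.exists_rational_of_stableCoset`, after the translation
   off the node at `11` of `X1ElevenNodeShift`) makes `R` rational up to `φ⁻¹⟨T̄'⟩`.
2. `finite_of_forall_eq_five_nsmul_add` — a finitely generated abelian group `A` with
   `A = 5A + ⟨t⟩`, `5t = 0`, is finite (Nakayama); with the **Mordell–Weil theorem** (tree
   `WeierstrassCurve.module_finite_point_holds`) `11A3(ℚ)` is finite.
3. `natCard_le_of_not_dvd` — reduction modulo a prime `p ≠ 11` of good reduction embeds every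
   finite subgroup of `11A3(ℚ)` of order prime to `p` into `Ẽ(𝔽_p)`, of order `≤ 2p + 1`
   (Silverman, *AEC*, VII.3.1); so there is no `2`-torsion (else a subgroup of order `10` at
   `p = 3`) and `#11A3(ℚ) ≤ 5` (`p = 2`): **`11A3(ℚ) = ⟨T⟩ ≅ ℤ/5`** (`zmultiples_T_eq_top`).
4. `billingMahler` — hence every rational solution of `y² + y = x³ - x²` has `y ∈ {0, -1}`
   (Billing–Mahler 1940), and by the tree's `Mazur1977_no_eleven_torsion_of_billingMahler`
   (`KubertTateEleven`): **no elliptic curve over `ℚ` has a rational point of order `11`**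
   (`Mazur1977_no_eleven_torsion`, the case `p = 11` of
   `Literature.NumberTheory.EllipticCurves.Mazur1977_no_prime_torsion`, for every `W/ℚ`), so
   that this named fact is reduced, for each `W`, to its cases `p ≥ 17`
   (`Mazur1977_no_prime_torsion_of_forall_seventeen_le`).

## References

* [Mazur1977] B. Mazur, *Modular curves and the Eisenstein ideal*, Publ. Math. IHÉS 47 (1977),
  Intro. Thm. (7) p. 35 (`m = 11`), Ch. III §3 Thm. (3.1), Ch. III §5 Cor. (5.3) p. 156.
* [BillingMahler1940] G. Billing, K. Mahler, *On exceptional points on cubic curves*, J. London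
  Math. Soc. 15 (1940), 32–43.
* [SilvermanAEC2009] J. H. Silverman, *The Arithmetic of Elliptic Curves*, 2nd ed. (2009),
  VII.3.1, VIII.§1, X.§4 Thm. 4.2, Exercise 10.1.
* [CremonaAlgorithms1997] J. E. Cremona, *Algorithms for Modular Elliptic Curves*, 2nd ed.
  (1997), Table 1, `N = 11` (A3: `r = 0`, `|T| = 5`).

## Design

Theorems and three `abbrev`s (`toGeom11A3`, `toGeom11A1`, and the integral equation
`curve11A3Int p`). The descent step is first proved with the global and local inputs as
hypotheses (`exists_eq_five_nsmul_add_of_descent`) and then specialised. The second half of the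
file switches off Mathlib's `DivisionRing.toRatAlgebra` (the `ℚ`-algebra diamond on `ℚ̄`; same
device as `GeomPointReduction`), after the `p`-adic part which needs it for `ℚ_p`.
-/

noncomputable section

open scoped Classical
open WeierstrassCurve

namespace Literature.NumberTheory.EllipticCurves.X1Eleven

open Literature.NumberTheory.EllipticCurves

/-! ## Part A. Two general inputs: Nakayama, and reduction modulo `p` -/

/-! ### A finitely generated abelian group `A` with `A = 5A + ⟨t⟩`, `5t = 0`, is finite -/

/-- **Nakayama step**: if `A` is a finitely generated abelian group, `t ∈ A` with `5 t = 0`, and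
every element of `A` is of the form `5 a + j t`, then `A` is finite (`A/⟨t⟩ = 5 · A/⟨t⟩`, so by
Nakayama some `r ≡ 1 (mod 5)` kills `A/⟨t⟩`; then `5r ≠ 0` kills `A`, a finitely generated
torsion group). [folklore] -/
theorem finite_of_forall_eq_five_nsmul_add {A : Type*} [AddCommGroup A] [Module.Finite ℤ A]
    {t : A} (ht : 5 • t = 0) (h : ∀ a : A, ∃ (b : A) (j : ℕ), a = 5 • b + j • t) : Finite A := by
  set F : Submodule ℤ A := Submodule.span ℤ {t} with hF
  haveI : Module.Finite ℤ (A ⧸ F) := Module.Finite.quotient ℤ F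
  have hle : (⊤ : Submodule ℤ (A ⧸ F)) ≤ (Ideal.span {((5 : ℕ) : ℤ)}) • ⊤ := by
    rintro m -
    obtain ⟨a, rfl⟩ := Submodule.Quotient.mk_surjective F m
    obtain ⟨b, j, hab⟩ := h a
    have hjt : Submodule.Quotient.mk (p := F) (j • t) = 0 := by
      rw [Submodule.Quotient.mk_eq_zero]
      exact Submodule.smul_of_tower_mem _ j (Submodule.subset_span rfl)
    have e : Submodule.Quotient.mk (p := F) a =
        ((5 : ℕ) : ℤ) • Submodule.Quotient.mk (p := F) b := by
      rw [hab, Submodule.Quotient.mk_add, hjt, add_zero, Nat.cast_smul_eq_nsmul]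
      exact map_nsmul F.mkQ 5 b
    rw [e]
    exact Submodule.smul_mem_smul (Ideal.mem_span_singleton_self _) Submodule.mem_top
  obtain ⟨r, hr1, hr⟩ := Submodule.exists_sub_one_mem_and_smul_eq_zero_of_fg_of_le_smul
    (Ideal.span {((5 : ℕ) : ℤ)}) (⊤ : Submodule ℤ (A ⧸ F)) Module.Finite.fg_top hle
  have hr0 : r ≠ 0 := by
    rintro rfl
    rw [zero_sub, Ideal.mem_span_singleton] at hr1
    omega
  have htors : Module.IsTorsion ℤ A := by
    intro a
    refine ⟨⟨5 * r, mem_nonZeroDivisors_of_ne_zero (mul_ne_zero (by norm_num) hr0)⟩, ?_⟩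
    have h1 : Submodule.Quotient.mk (p := F) (r • a) = 0 := by
      rw [Submodule.Quotient.mk_smul]; exact hr _ Submodule.mem_top
    rw [Submodule.Quotient.mk_eq_zero, hF, Submodule.mem_span_singleton] at h1
    obtain ⟨z, hz⟩ := h1
    show (5 * r) • a = 0
    have h5t : (5 : ℤ) • t = 0 := (Nat.cast_smul_eq_nsmul ℤ 5 t).trans ht
    rw [mul_smul, ← hz, smul_comm, h5t, smul_zero]
  exact Module.finite_of_fg_torsion A htors

/-! ### Reduction modulo `p` bounds prime-to-`p` subgroups with nonsingular reduction -/

section Reduction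

variable {K : Type*} [Field K] {Γ₀ : Type*} [LinearOrderedCommGroupWithZero Γ₀]
  {v : Valuation K Γ₀} {R : Type*} [CommRing R] [IsLocalRing R] [Algebra R K]
  {W : WeierstrassCurve R}

/-- **Reduction embeds a prime-to-`p` finite subgroup of `E₀(K)` into `Ẽ_ns(k)`** (Silverman,
*AEC*, VII.2.1 with VII.3.1: `E₀(K) → Ẽ_ns(k)` has kernel `E₁(K)`, which has no `n`-torsion
for `v n = 1`): if every `P ∈ B` has nonsingular reduction and `n • P = O` with `v n = 1`, then
`#B ≤ #Ẽ_ns(k)`. (Subgroup version of the tree's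
`addOrderOf_le_natCard_of_hasNonsingularReduction`.)
[cite: SilvermanAEC2009, VII.2 Prop. 2.1 and VII.3 Prop. 3.1 (PDF pp. 167–171)] -/
theorem natCard_le_of_hasNonsingularReduction (hv : v.Integers R)
    [Finite (W.map (IsLocalRing.residue R)).toAffine.Point]
    (B : AddSubgroup (W.baseChange K).toAffine.Point)
    (hB : ∀ P ∈ B, W.HasNonsingularReduction P) {n : ℤ} (hn : v (n : K) = 1)
    (hnB : ∀ P ∈ B, n • P = 0) :
    Nat.card B ≤ Nat.card (W.map (IsLocalRing.residue R)).toAffine.Point := by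
  have hle : B ≤ W.nonsingularReductionSubgroup hv := fun P hP => hB P hP
  set f : B →+ (W.map (IsLocalRing.residue R)).toAffine.Point :=
    (W.reductionHom hv).comp (AddSubgroup.inclusion hle) with hf_def
  have hf : Function.Injective f := by
    rw [injective_iff_map_eq_zero]
    rintro ⟨Q, hQ⟩ hfQ
    have hred : W.reducePoint Q = 0 := hfQ
    have h0 : W.ReducesToZero Q :=
      (_root_.WeierstrassCurve.reducePoint_eq_zero_iff hv (hle hQ)).mp hred
    by_contra hne
    exact not_reducesToZero_of_zsmul_eq_zero hv hn (hnB Q hQ) (fun h => hne (Subtype.ext h)) h0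
  exact Nat.card_le_card_of_injective f hf

end Reduction

/-! ### `11A3` over `ℤ_p`, `p ≠ 11` -/

/-- The `ℤ_p`-integral equation `y² + y = x³ - x²` of `11A3`.
[cite: CremonaAlgorithms1997, Table 1, N = 11, curve A3 [0,-1,1,0,0]] -/
abbrev curve11A3Int (p : ℕ) [Fact p.Prime] : WeierstrassCurve ℤ_[p] := ⟨0, -1, 1, 0, 0⟩

section Padic

variable (p : ℕ) [Fact p.Prime]

/-- `11A3 ⊗ ℚ_p` is the base change of the integral equation. [folklore] -/
theorem curve11A3_baseChange_padic :
    curve11A3.baseChange ℚ_[p] = (curve11A3Int p).baseChange ℚ_[p] := by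
  simp only [WeierstrassCurve.baseChange, WeierstrassCurve.map, curve11A3, map_zero, map_one,
    map_neg]

/-- `Δ(11A3) = -11` over `ℤ_p`. [cite: CremonaAlgorithms1997, Table 1, N = 11, curve A3] -/
theorem curve11A3Int_Δ : (curve11A3Int p).Δ = -11 := by
  simp only [WeierstrassCurve.Δ, WeierstrassCurve.b₂, WeierstrassCurve.b₄, WeierstrassCurve.b₆,
    WeierstrassCurve.b₈]
  norm_num

/-- `11A3` has good reduction at every `p ≠ 11`: `-11 ∈ ℤ_pˣ`.
[cite: CremonaAlgorithms1997, Table 1, N = 11 (conductor 11)] -/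
theorem isUnit_Δ_curve11A3Int (hp : p ≠ 11) : IsUnit (curve11A3Int p).Δ := by
  rw [curve11A3Int_Δ, IsUnit.neg_iff, PadicInt.isUnit_iff]
  refine le_antisymm (PadicInt.norm_le_one _) (not_lt.mp fun hlt => hp ?_)
  have h := (PadicInt.norm_int_lt_one_iff_dvd (p := p) 11).mp (by exact_mod_cast hlt)
  have h' : p ∣ 11 := by exact_mod_cast h
  exact ((Nat.prime_dvd_prime_iff_eq Fact.out (by decide)).mp h')

/-- An integer prime to `p` is a `p`-adic unit: `v(n) = 1` for the valuation of `ℚ_p`.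
[folklore] -/
theorem valuation_natCast_eq_one {n : ℕ} (hn : ¬ p ∣ n) :
    ValuationRing.valuation ℤ_[p] ℚ_[p] ((n : ℤ) : ℚ_[p]) = 1 := by
  have hv := integers_valuationRing_valuation ℤ_[p] ℚ_[p]
  rw [show ((n : ℤ) : ℚ_[p]) = algebraMap ℤ_[p] ℚ_[p] (n : ℤ_[p]) by simp,
    v_algebraMap_eq_one_iff hv]
  intro h0
  rw [map_natCast] at h0
  have h := congrArg (PadicInt.residueField (p := p)) h0
  rw [map_natCast, map_zero, ZMod.natCast_eq_zero_iff] at h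
  exact hn h

/-- **The prime-to-`p` subgroups of `11A3(ℚ)` are small**: for a prime `p ≠ 11` and a finite
subgroup `B ≤ 11A3(ℚ)` of order prime to `p`, `#B ≤ 2p + 1` (reduction modulo `p` is injective
on `B`, Silverman *AEC* VII.3.1(b), and `#Ẽ(𝔽_p) ≤ 2p + 1`).
[cite: SilvermanAEC2009, VII.3 Prop. 3.1(b) (PDF p. 171)] -/
theorem natCard_le_of_not_dvd (hp : p ≠ 11) (B : AddSubgroup curve11A3.toAffine.Point)
    [Finite B] (hB : ¬ p ∣ Nat.card B) : Nat.card B ≤ 2 * p + 1 := by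
  have hv := integers_valuationRing_valuation ℤ_[p] ℚ_[p]
  have hW := curve11A3_baseChange_padic p
  -- `11A3(ℚ) → (11A3/ℤ_p)(ℚ_p)`
  set ι : curve11A3.toAffine.Point →+ ((curve11A3Int p).baseChange ℚ_[p]).toAffine.Point :=
    (Affine.Point.congrEquiv hW).toAddMonoidHom.comp
      (Affine.Point.map (W' := curve11A3.toAffine) (S := ℚ) (Algebra.ofId ℚ ℚ_[p])) with hι
  have hιinj : Function.Injective ι :=
    (Affine.Point.congrEquiv hW).injective.comp
      (Affine.Point.map_injective (W' := curve11A3.toAffine) (f := Algebra.ofId ℚ ℚ_[p]))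
  set B' := B.map ι with hB'
  have hcardB' : Nat.card B' = Nat.card B :=
    (Nat.card_congr (B.equivMapOfInjective ι hιinj).toEquiv).symm
  haveI : Finite (IsLocalRing.ResidueField ℤ_[p]) :=
    Finite.of_equiv (ZMod p) (PadicInt.residueField (p := p)).symm.toEquiv
  haveI : Fintype (IsLocalRing.ResidueField ℤ_[p]) := Fintype.ofFinite _
  haveI : Finite ((curve11A3Int p).map (IsLocalRing.residue ℤ_[p])).toAffine.Point :=
    finite_point _
  have hns : ∀ P ∈ B', (curve11A3Int p).HasNonsingularReduction P := fun P _ =>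
    hasNonsingularReduction_of_isUnit_Δ hv (isUnit_Δ_curve11A3Int p hp) P
  have hkill : ∀ P ∈ B', ((Nat.card B : ℕ) : ℤ) • P = 0 := by
    rintro _ ⟨Q, hQ, rfl⟩
    have h1 : (Nat.card B • (⟨Q, hQ⟩ : B) : B) = 0 := card_nsmul_eq_zero'
    have h2 : Nat.card B • Q = 0 := by
      have h1' := congrArg Subtype.val h1
      rwa [AddSubmonoidClass.coe_nsmul, ZeroMemClass.coe_zero] at h1'
    rw [natCast_zsmul, ← map_nsmul, h2, map_zero]
  have hn : ValuationRing.valuation ℤ_[p] ℚ_[p] (((Nat.card B : ℕ) : ℤ) : ℚ_[p]) = 1 :=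
    valuation_natCast_eq_one p hB
  calc Nat.card B = Nat.card B' := hcardB'.symm
    _ ≤ Nat.card ((curve11A3Int p).map (IsLocalRing.residue ℤ_[p])).toAffine.Point :=
        natCard_le_of_hasNonsingularReduction hv B' hns hn hkill
    _ ≤ 2 * Fintype.card (IsLocalRing.ResidueField ℤ_[p]) + 1 :=
        natCard_point_le_two_mul_card_add_one' _
    _ = 2 * p + 1 := by rw [← Nat.card_eq_fintype_card, natCard_residueField_padicInt]

end Padic

end Literature.NumberTheory.EllipticCurves.X1Eleven

-- The `ℚ`-algebra diamond on `AlgebraicClosure ℚ` (`DivisionRing.toRatAlgebra` vs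
-- `AlgebraicClosure.instAlgebra`, defeq but not at instance transparency): `geomPoints`,
-- `geomFunctionField`, the Galois action and the tree's `ord` are keyed on the latter, so from
-- here on `11A3 ⊗ ℚ̄` is read with it (same device as in `GeomPointReduction`); the `p`-adic part
-- above needs `DivisionRing.toRatAlgebra` for `ℚ_p` and therefore comes first.
attribute [-instance] DivisionRing.toRatAlgebra

namespace Literature.NumberTheory.EllipticCurves.X1Eleven

open Literature.NumberTheory.EllipticCurves

/-! ## Part B. The descent on `X₁(11)` and its consequences -/

/-! ### The embeddings `11A3(ℚ) → 11A3(ℚ̄)`, `11A1(ℚ) → 11A1(ℚ̄)` -/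

/-- `11A3(ℚ) → 11A3(ℚ̄)` (Mathlib's `Affine.Point.map` along `ℚ → ℚ̄`; pointwise the tree's
`toGeomPoints curve11A3`, spelled with this file's instances). [folklore] -/
abbrev toGeom11A3 : curve11A3.toAffine.Point →+ geomPoints curve11A3 :=
  Affine.Point.map (W' := curve11A3.toAffine) (S := ℚ) (Algebra.ofId ℚ (AlgebraicClosure ℚ))

/-- `11A1(ℚ) → 11A1(ℚ̄)`. [folklore] -/
abbrev toGeom11A1 : curve11A1.toAffine.Point →+ geomPoints curve11A1 :=
  Affine.Point.map (W' := curve11A1.toAffine) (S := ℚ) (Algebra.ofId ℚ (AlgebraicClosure ℚ))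

/-- `toGeom11A3 T = T̄`. [folklore] -/
theorem toGeom11A3_T : toGeom11A3 T = Tbar := toGeomPoints_T

/-- `toGeom11A1 T' = T̄'`. [folklore] -/
theorem toGeom11A1_T' : toGeom11A1 T' = T'bar := rfl

/-- `toGeom11A3` is injective. [folklore] -/
theorem toGeom11A3_injective : Function.Injective toGeom11A3 :=
  Affine.Point.map_injective (W' := curve11A3.toAffine) (f := Algebra.ofId ℚ (AlgebraicClosure ℚ))

/-- Rational points are `Γ_ℚ`-fixed. [folklore] -/
theorem smul_toGeom11A3 (σ : Field.absoluteGaloisGroup ℚ) (P : curve11A3.toAffine.Point) :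
    σ • toGeom11A3 P = toGeom11A3 P := smul_toGeomPoints curve11A3 σ P

/-- `toGeom11A3` on an affine point. [folklore] -/
theorem toGeom11A3_some {x y : ℚ} (h : curve11A3.toAffine.Nonsingular x y) :
    ∃ h', toGeom11A3 (Affine.Point.some x y h) = Affine.Point.some (algebraMap ℚ (AlgebraicClosure ℚ) x)
      (algebraMap ℚ (AlgebraicClosure ℚ) y) h' :=
  ⟨_, Affine.Point.map_some (W' := curve11A3.toAffine) (Algebra.ofId ℚ (AlgebraicClosure ℚ)) h⟩

/-- Galois descent on `11A1`: a `Γ_ℚ`-fixed geometric point is rational (tree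
`exists_toGeomPoints_eq_of_forall_smul_eq`). [cite: SilvermanAEC2009, VIII.§1 (proof of Prop. 1.2)] -/
theorem exists_toGeom11A1_eq {Q : geomPoints curve11A1}
    (hQ : ∀ σ : Field.absoluteGaloisGroup ℚ, σ • Q = Q) :
    ∃ P' : curve11A1.toAffine.Point, toGeom11A1 P' = Q :=
  exists_toGeomPoints_eq_of_forall_smul_eq (W := curve11A1) hQ

/-- `σ • (k • Q) = k • (σ • Q)`. [folklore] -/
theorem smul_nsmul_comm (σ : Field.absoluteGaloisGroup ℚ) (k : ℕ) (Q : geomPoints curve11A3) :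
    σ • (k • Q) = k • (σ • Q) :=
  map_nsmul (DistribSMul.toAddMonoidHom (geomPoints curve11A3) σ) k Q

/-! ### The value of `f_T` at the points of `⟨T̄⟩ ∖ {O, T̄}` is `±1` -/

/-- On `⟨T̄⟩ ∖ {O, T̄} = {(1,-1), (1,0), (0,-1)}` the Kummer function takes the rational values
`-1, 1, -1`. [cite: SilvermanAEC2009, Exercise 10.1(c) (PDF p. 304)] -/
theorem exists_hasValueAt_of_mem_zmultiples_Tbar {S : geomPoints curve11A3}
    (hS : S ∈ AddSubgroup.zmultiples Tbar) (hS0 : S ≠ 0) (hST : S ≠ Tbar) :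
    ∃ β : ℚ, (β = 1 ∨ β = -1) ∧
      curve11A3.HasValueAt kummerFn S (algebraMap ℚ (AlgebraicClosure ℚ) β) := by
  rw [← ker_fiveIsogeny] at hS
  rcases mem_ker_fiveIsogeny_imp hS with rfl | ⟨a, b, h, rfl, ha, hb⟩
  · exact (hS0 rfl).elim
  have hv := hasValueAt_kummerFn h
  rcases ha with rfl | rfl <;> rcases hb with rfl | rfl
  · exact (hST rfl).elim
  · exact ⟨-1, Or.inr rfl, hv.congr rfl (by rw [map_neg, map_one]; ring)⟩
  · exact ⟨1, Or.inl rfl, hv.congr rfl (by rw [map_one]; ring)⟩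
  · exact ⟨-1, Or.inr rfl, hv.congr rfl (by rw [map_neg, map_one]; ring)⟩

/-! ### Step 1: `11A3(ℚ) ⊆ 5 · 11A3(ℚ) + ⟨T⟩` -/

/-- **The `5`-descent on `X₁(11)`**, with the global step (`H4b`,
`X1ElevenDescentGalois.exists_rational_of_stableCoset`) and the local step at `11` (`H4c`,
`X1ElevenNodeShift.exists_sub_nsmul_T'_not_node`) as hypotheses: every rational point of `11A3`
lies in `5 · 11A3(ℚ) + ⟨T⟩`. Proof (Mazur, Ch. III §3 for `N = 11`; Silverman, *AEC*, X.§4 with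
Exercise 10.1): for `P ∉ {O, T}`, `f_T(P) ∈ (ℚˣ)⁵` (`exists_kummerF_eq_pow_five`), so by the
Kummer form of the descent through `⟨T̄⟩` (`exists_stableCoset_of_kummer_eq_pow`, with the
divisor of `f_T` from `X1ElevenKummerDivisor` and the values `f_T(⟨T̄⟩ ∖ {O,T̄}) = ±1`) there is
`R` with `5R = P` and `R + ⟨T̄⟩` `Γ_ℚ`-stable; then `φ R ∈ 11A1(ℚ)` (Galois descent), a
translate `φ R - k T'` misses the node at `11` (`H4c`), so `R - k Q₀` is rational (`H4b`,
`φ Q₀ = T̄'`), and `P = 5(R - k Q₀) + k · 5Q₀ ∈ 5 E(ℚ) + ⟨T⟩`.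
[cite: Mazur1977, Ch. III §3 Thm. (3.1) and Intro. pp. 34–35; SilvermanAEC2009, X.§4 Thm. 4.2 and Exercise 10.1] -/
theorem exists_eq_five_nsmul_add_of_descent
    (H4b : ∀ {R : geomPoints curve11A3},
      (∀ σ : Field.absoluteGaloisGroup ℚ, σ • R - R ∈ AddSubgroup.zmultiples Tbar) →
      ∀ {P' : curve11A1.toAffine.Point}, fiveIsogeny R = toGeom11A1 P' →
        (¬ ∃ (x y : ℚ) (h : curve11A1.toAffine.Nonsingular x y), P' = Affine.Point.some x y h ∧
          ¬ (11 : ℤ) ∣ x.den ∧ ¬ (11 : ℤ) ∣ y.den ∧ (11 : ℤ) ∣ x.num - 5 * x.den ∧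
            (11 : ℤ) ∣ y.num - 5 * y.den) →
        ∃ Q₁ : curve11A3.toAffine.Point, toGeom11A3 Q₁ = R)
    (H4c : ∀ P' : curve11A1.toAffine.Point, ∃ k : ℕ, k < 5 ∧
      ¬ ∃ (x y : ℚ) (h : curve11A1.toAffine.Nonsingular x y),
        P' - k • T' = Affine.Point.some x y h ∧ ¬ (11 : ℤ) ∣ x.den ∧ ¬ (11 : ℤ) ∣ y.den ∧
          (11 : ℤ) ∣ x.num - 5 * x.den ∧ (11 : ℤ) ∣ y.num - 5 * y.den)
    (P : curve11A3.toAffine.Point) :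
    ∃ (Q₁ : curve11A3.toAffine.Point) (j : ℕ), P = 5 • Q₁ + j • T := by
  -- the trivial cases `P = O`, `P = T`
  by_cases hP0 : P = 0
  · exact ⟨0, 0, by rw [hP0, nsmul_zero, zero_nsmul, add_zero]⟩
  by_cases hPT : P = T
  · exact ⟨0, 1, by rw [hPT, nsmul_zero, one_nsmul, zero_add]⟩
  -- coordinates of `P`
  rcases P with _ | ⟨x, y, hxy⟩
  · exact (hP0 rfl).elim
  have hE : y ^ 2 + y = x ^ 3 - x ^ 2 := (curve11A3_equation_iff x y).mp hxy.1
  have hxy0 : ¬ (x = 0 ∧ y = 0) := by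
    rintro ⟨rfl, rfl⟩
    exact hPT rfl
  -- `f_T(P) = u⁵`
  obtain ⟨u, -, hu⟩ := exists_kummerF_eq_pow_five hE hxy0
  -- the geometric point `P̄`
  obtain ⟨Pg, hPg⟩ : ∃ Pg : geomPoints curve11A3, Pg = toGeom11A3 (Affine.Point.some x y hxy) := ⟨_, rfl⟩
  obtain ⟨hxy', hPge⟩ := toGeom11A3_some hxy
  have hPfix : ∀ σ : Field.absoluteGaloisGroup ℚ, σ • Pg = Pg := fun σ => by
    rw [hPg]; exact smul_toGeom11A3 σ _
  have hPg0 : Pg ≠ 0 := by rw [hPg, hPge]; exact Affine.Point.some_ne_zero _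
  have hPgT : Pg ≠ Tbar := by
    rw [hPg, ← toGeom11A3_T]
    exact fun h => hPT (toGeom11A3_injective h)
  have ha : curve11A3.HasValueAt kummerFn Pg (algebraMap ℚ (AlgebraicClosure ℚ) (u ^ 5)) := by
    rw [hPg, hPge]
    refine (hasValueAt_kummerFn hxy').congr rfl ?_
    rw [← hu, kummerF, map_add, map_add, map_mul, map_pow]
  -- `T̄`, and a `φ`-preimage `Q₀` of `T̄'` with stable coset
  have hT5 : ((5 : ℕ) : ℤ) • Tbar = 0 := by rw [natCast_zsmul]; exact five_nsmul_Tbar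
  obtain ⟨Q₀, hQ₀φ, hQ₀stab, hQ₀5, hQ₀50⟩ := exists_stableCoset_over_T'
  -- normalise: `R₂ ∈ {Q₀, 2 Q₀}` with `5 R₂ ∈ ⟨T̄⟩ ∖ {O, T̄}`
  obtain ⟨R₂, hR₂stab, hR₂0, hR₂T, hR₂mem⟩ : ∃ R₂ : geomPoints curve11A3,
      (∀ σ : Field.absoluteGaloisGroup ℚ, σ • R₂ - R₂ ∈ AddSubgroup.zmultiples Tbar) ∧
      ((5 : ℕ) : ℤ) • R₂ ≠ 0 ∧ ((5 : ℕ) : ℤ) • R₂ ≠ Tbar ∧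
      ((5 : ℕ) : ℤ) • R₂ ∈ AddSubgroup.zmultiples Tbar := by
    by_cases h5T : (5 : ℕ) • Q₀ = Tbar
    · have e : ((5 : ℕ) : ℤ) • (2 • Q₀) = Tbar + Tbar := by
        rw [natCast_zsmul, ← mul_nsmul, mul_nsmul', h5T, two_nsmul]
      refine ⟨2 • Q₀, fun σ => ?_, ?_, ?_, ?_⟩
      · rw [smul_nsmul_comm, ← nsmul_sub]
        exact nsmul_mem (hQ₀stab σ) 2
      · rw [e, ← two_nsmul]
        intro h
        have h1 : addOrderOf Tbar ∣ 2 := addOrderOf_dvd_of_nsmul_eq_zero h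
        rw [addOrderOf_Tbar] at h1
        omega
      · rw [e]
        exact fun h => Tbar_ne_zero (add_eq_left.mp h)
      · rw [e]
        exact add_mem (AddSubgroup.mem_zmultiples _) (AddSubgroup.mem_zmultiples _)
    · exact ⟨Q₀, hQ₀stab, by rw [natCast_zsmul]; exact hQ₀50, by rw [natCast_zsmul]; exact h5T,
        by rw [natCast_zsmul]; exact hQ₀5⟩
  -- `f_T(5 R₂) = β = ±1`, and `u⁵ = (β u)⁵ β`
  obtain ⟨β, hβ, hb⟩ := exists_hasValueAt_of_mem_zmultiples_Tbar hR₂mem hR₂0 hR₂T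
  have hab : algebraMap ℚ (AlgebraicClosure ℚ) (u ^ 5) =
      algebraMap ℚ (AlgebraicClosure ℚ) (β * u) ^ 5 * algebraMap ℚ (AlgebraicClosure ℚ) β := by
    rw [← map_pow, ← map_mul]
    congr 1
    rcases hβ with rfl | rfl <;> ring
  -- the Kummer-form descent: `R` with `5 R = P̄` and stable coset
  obtain ⟨R, hR5, hRstab⟩ := exists_stableCoset_of_kummer_eq_pow (F := ℚ) (W := curve11A3)
    (N := 5) hT5 Tbar_ne_zero smul_Tbar kummerFn_ne_zero ord_kummerFn hR₂stab hR₂0 hR₂T hPfix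
    hPg0 hPgT ha hb hab
  -- `φ R` is `Γ_ℚ`-fixed, hence rational: `φ R = toGeom11A1 P'`
  have hφRfix : ∀ σ : Field.absoluteGaloisGroup ℚ, σ • fiveIsogeny R = fiveIsogeny R := by
    intro σ
    have hmem := hRstab σ
    rw [← ker_fiveIsogeny, AddMonoidHom.mem_ker] at hmem
    have h0 : fiveIsogeny (σ • R - R) = 0 := hmem
    rw [map_sub, sub_eq_zero, fiveIsogeny.map_smul] at h0
    exact h0
  obtain ⟨P', hP'⟩ := exists_toGeom11A1_eq hφRfix
  -- translate off the node at `11`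
  obtain ⟨k, -, hnode⟩ := H4c P'
  -- the coset of `R₁ = R - k Q₀` is stable and `φ R₁ = toGeom11A1 (P' - k T')`
  have hR₁stab : ∀ σ : Field.absoluteGaloisGroup ℚ,
      σ • (R - k • Q₀) - (R - k • Q₀) ∈ AddSubgroup.zmultiples Tbar := by
    intro σ
    rw [smul_sub, smul_nsmul_comm,
      show σ • R - k • σ • Q₀ - (R - k • Q₀) = (σ • R - R) - k • (σ • Q₀ - Q₀) by
        rw [nsmul_sub]; abel]
    exact sub_mem (hRstab σ) (nsmul_mem (hQ₀stab σ) k)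
  have hφ₁ : fiveIsogeny (R - k • Q₀) = toGeom11A1 (P' - k • T') := by
    rw [map_sub, map_nsmul, map_sub, map_nsmul, hQ₀φ, hP', toGeom11A1_T']
  obtain ⟨Q₁, hQ₁⟩ := H4b hR₁stab hφ₁ hnode
  -- `5 Q₀ = m T̄`
  obtain ⟨m, hm⟩ := exists_nsmul_eq_of_mem_zmultiples (W := curve11A3) (N := 5) hT5 hQ₀5
  -- conclusion: `P = 5 Q₁ + (k m) T`
  refine ⟨Q₁, k * m, toGeom11A3_injective ?_⟩
  have hcomm : k • (5 : ℕ) • Q₀ = (5 : ℕ) • k • Q₀ := by rw [← mul_nsmul, mul_nsmul']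
  rw [← hPg, map_add, map_nsmul, map_nsmul, hQ₁, toGeom11A3_T, ← hR5, natCast_zsmul, nsmul_sub,
    mul_nsmul', hm, hcomm, sub_add_cancel]

/-! ### Step 2: finiteness of `11A3(ℚ)` (Mordell–Weil + Nakayama) -/

/-- `5 T = O`. [folklore] -/
theorem five_nsmul_T : 5 • T = 0 := by
  rw [← addOrderOf_T]; exact addOrderOf_nsmul_eq_zero T

/-- **`11A3(ℚ)` is finite** (granted the descent inputs): by the Mordell–Weil theorem (tree
`WeierstrassCurve.module_finite_point_holds`) `11A3(ℚ)` is finitely generated, and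
`11A3(ℚ) = 5 · 11A3(ℚ) + ⟨T⟩` (Step 1) forces finiteness (Nakayama).
[cite: Mazur1977, Ch. III §3 and Intro. Thm. (7); SilvermanAEC2009, Thm. VIII.6.7] -/
theorem finite_point_of_descent
    (H4b : ∀ {R : geomPoints curve11A3},
      (∀ σ : Field.absoluteGaloisGroup ℚ, σ • R - R ∈ AddSubgroup.zmultiples Tbar) →
      ∀ {P' : curve11A1.toAffine.Point}, fiveIsogeny R = toGeom11A1 P' →
        (¬ ∃ (x y : ℚ) (h : curve11A1.toAffine.Nonsingular x y), P' = Affine.Point.some x y h ∧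
          ¬ (11 : ℤ) ∣ x.den ∧ ¬ (11 : ℤ) ∣ y.den ∧ (11 : ℤ) ∣ x.num - 5 * x.den ∧
            (11 : ℤ) ∣ y.num - 5 * y.den) →
        ∃ Q₁ : curve11A3.toAffine.Point, toGeom11A3 Q₁ = R)
    (H4c : ∀ P' : curve11A1.toAffine.Point, ∃ k : ℕ, k < 5 ∧
      ¬ ∃ (x y : ℚ) (h : curve11A1.toAffine.Nonsingular x y),
        P' - k • T' = Affine.Point.some x y h ∧ ¬ (11 : ℤ) ∣ x.den ∧ ¬ (11 : ℤ) ∣ y.den ∧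
          (11 : ℤ) ∣ x.num - 5 * x.den ∧ (11 : ℤ) ∣ y.num - 5 * y.den) :
    Finite curve11A3.toAffine.Point := by
  -- Mordell–Weil (the tree's theorem is stated for the classical `DecidableEq ℚ` instance of the
  -- group law; the instances are subsingletons, `convert` identifies them)
  haveI : Module.Finite ℤ curve11A3.toAffine.Point := by
    convert module_finite_point_holds curve11A3
  exact finite_of_forall_eq_five_nsmul_add five_nsmul_T
    (exists_eq_five_nsmul_add_of_descent H4b H4c)

/-! ### Step 3: `11A3(ℚ) = ⟨T⟩` -/

/-- **`11A3(ℚ) = ⟨T⟩ ≅ ℤ/5`** (granted the descent inputs): `11A3(ℚ)` is finite; an element of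
order `2` would give a subgroup `⟨P + T⟩` of order `10`, too big for `Ẽ(𝔽₃)` (`≤ 7` points);
so `#11A3(ℚ)` is odd and embeds into `Ẽ(𝔽₂)` (`≤ 5` points), while `5 ∣ #11A3(ℚ)`.
[cite: CremonaAlgorithms1997, Table 1, N = 11, curve A3 (r = 0, |T| = 5); Mazur1977, Ch. III §5 Cor. (5.3) p. 156] -/
theorem zmultiples_T_eq_top_of_descent
    (H4b : ∀ {R : geomPoints curve11A3},
      (∀ σ : Field.absoluteGaloisGroup ℚ, σ • R - R ∈ AddSubgroup.zmultiples Tbar) →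
      ∀ {P' : curve11A1.toAffine.Point}, fiveIsogeny R = toGeom11A1 P' →
        (¬ ∃ (x y : ℚ) (h : curve11A1.toAffine.Nonsingular x y), P' = Affine.Point.some x y h ∧
          ¬ (11 : ℤ) ∣ x.den ∧ ¬ (11 : ℤ) ∣ y.den ∧ (11 : ℤ) ∣ x.num - 5 * x.den ∧
            (11 : ℤ) ∣ y.num - 5 * y.den) →
        ∃ Q₁ : curve11A3.toAffine.Point, toGeom11A3 Q₁ = R)
    (H4c : ∀ P' : curve11A1.toAffine.Point, ∃ k : ℕ, k < 5 ∧
      ¬ ∃ (x y : ℚ) (h : curve11A1.toAffine.Nonsingular x y),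
        P' - k • T' = Affine.Point.some x y h ∧ ¬ (11 : ℤ) ∣ x.den ∧ ¬ (11 : ℤ) ∣ y.den ∧
          (11 : ℤ) ∣ x.num - 5 * x.den ∧ (11 : ℤ) ∣ y.num - 5 * y.den) :
    AddSubgroup.zmultiples T = (⊤ : AddSubgroup curve11A3.toAffine.Point) := by
  haveI := finite_point_of_descent H4b H4c
  have hT5 : addOrderOf T = 5 := addOrderOf_T
  have h5n : 5 ∣ Nat.card curve11A3.toAffine.Point := hT5 ▸ addOrderOf_dvd_natCard T
  have hn0 : Nat.card curve11A3.toAffine.Point ≠ 0 := Nat.card_pos.ne'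
  -- no element of order `2` (reduction modulo `3`)
  have h2 : ¬ 2 ∣ Nat.card curve11A3.toAffine.Point := by
    intro h2n
    haveI : Fact (Nat.Prime 2) := ⟨Nat.prime_two⟩
    haveI : Fact (Nat.Prime 3) := ⟨Nat.prime_three⟩
    obtain ⟨P, hP⟩ :=
      exists_prime_addOrderOf_dvd_card' (G := curve11A3.toAffine.Point) 2 h2n
    have hord : addOrderOf (P + T) = 10 := by
      rw [(AddCommute.all P T).addOrderOf_add_eq_mul_addOrderOf_of_coprime
        (by rw [hP, hT5]; decide), hP, hT5]
    have hcard : Nat.card (AddSubgroup.zmultiples (P + T)) = 10 := by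
      rw [Nat.card_zmultiples, hord]
    have hle := natCard_le_of_not_dvd 3 (by decide) (AddSubgroup.zmultiples (P + T))
      (by rw [hcard]; decide)
    rw [hcard] at hle
    omega
  -- `#11A3(ℚ) ≤ 5` by reduction modulo `2`, hence `= 5`
  haveI : Fact (Nat.Prime 2) := ⟨Nat.prime_two⟩
  have hle := natCard_le_of_not_dvd 2 (by decide) (⊤ : AddSubgroup curve11A3.toAffine.Point)
    (by rwa [AddSubgroup.card_top])
  rw [AddSubgroup.card_top] at hle
  have hn5 : Nat.card curve11A3.toAffine.Point = 5 := by omega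
  exact AddSubgroup.eq_top_of_card_eq _ (by rw [Nat.card_zmultiples, hT5, hn5])

/-! ### Step 4: Billing–Mahler -/

/-- **Billing–Mahler (1940), granted the descent inputs**: every rational solution of
`y² + y = x³ - x²` has `y = 0` or `y = -1` (the point `(x, y)` lies in `⟨T⟩`, whose affine
points are `(0,0), (1,-1), (1,0), (0,-1)`).
[cite: BillingMahler1940, main theorem; CremonaAlgorithms1997, Table 1, N = 11, curve A3] -/
theorem billingMahler_of_descent
    (H4b : ∀ {R : geomPoints curve11A3},
      (∀ σ : Field.absoluteGaloisGroup ℚ, σ • R - R ∈ AddSubgroup.zmultiples Tbar) →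
      ∀ {P' : curve11A1.toAffine.Point}, fiveIsogeny R = toGeom11A1 P' →
        (¬ ∃ (x y : ℚ) (h : curve11A1.toAffine.Nonsingular x y), P' = Affine.Point.some x y h ∧
          ¬ (11 : ℤ) ∣ x.den ∧ ¬ (11 : ℤ) ∣ y.den ∧ (11 : ℤ) ∣ x.num - 5 * x.den ∧
            (11 : ℤ) ∣ y.num - 5 * y.den) →
        ∃ Q₁ : curve11A3.toAffine.Point, toGeom11A3 Q₁ = R)
    (H4c : ∀ P' : curve11A1.toAffine.Point, ∃ k : ℕ, k < 5 ∧
      ¬ ∃ (x y : ℚ) (h : curve11A1.toAffine.Nonsingular x y),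
        P' - k • T' = Affine.Point.some x y h ∧ ¬ (11 : ℤ) ∣ x.den ∧ ¬ (11 : ℤ) ∣ y.den ∧
          (11 : ℤ) ∣ x.num - 5 * x.den ∧ (11 : ℤ) ∣ y.num - 5 * y.den)
    (x y : ℚ) (hE : y ^ 2 + y = x ^ 3 - x ^ 2) : y = 0 ∨ y = -1 := by
  have hns : curve11A3.toAffine.Nonsingular x y :=
    (Affine.equation_iff_nonsingular).mp ((curve11A3_equation_iff x y).mpr hE)
  have hmem : Affine.Point.some x y hns ∈ AddSubgroup.zmultiples T := by
    rw [zmultiples_T_eq_top_of_descent H4b H4c]; exact AddSubgroup.mem_top _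
  obtain ⟨k, hk⟩ := AddSubgroup.mem_zmultiples_iff.mp hmem
  have hgeom : toGeom11A3 (Affine.Point.some x y hns) ∈ AddSubgroup.zmultiples Tbar := by
    rw [← hk, map_zsmul, toGeom11A3_T]
    exact AddSubgroup.zsmul_mem _ (AddSubgroup.mem_zmultiples _) k
  rw [← ker_fiveIsogeny] at hgeom
  obtain ⟨h', he⟩ := toGeom11A3_some hns
  rcases mem_ker_fiveIsogeny_imp hgeom with h0 | ⟨a, b, hab, heq, -, hb⟩
  · rw [he] at h0
    exact absurd h0 (Affine.Point.some_ne_zero _)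
  · rw [he] at heq
    obtain ⟨-, hyb⟩ := Affine.Point.some.inj heq
    have hinj := (algebraMap ℚ (AlgebraicClosure ℚ)).injective
    rcases hb with rfl | rfl
    · exact Or.inl (hinj (by rw [hyb, map_zero]))
    · exact Or.inr (hinj (by rw [hyb, map_neg, map_one]))

/-! ## The theorems -/

/-- **`11A3(ℚ) ⊆ 5 · 11A3(ℚ) + ⟨T⟩`** (Step 1 with the tree's global and local steps
`exists_rational_of_stableCoset`, `exists_sub_nsmul_T'_not_node`).
[cite: Mazur1977, Ch. III §3 Thm. (3.1) and Intro. pp. 34–35; SilvermanAEC2009, X.§4 Thm. 4.2 and Exercise 10.1] -/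
theorem exists_eq_five_nsmul_add (P : curve11A3.toAffine.Point) :
    ∃ (Q₁ : curve11A3.toAffine.Point) (j : ℕ), P = 5 • Q₁ + j • T :=
  exists_eq_five_nsmul_add_of_descent
    (fun hR _ hφ hnode => exists_rational_of_stableCoset hR hφ hnode)
    exists_sub_nsmul_T'_not_node P

/-- **`11A3(ℚ) = ⟨(0,0)⟩ ≅ ℤ/5`** — the Mordell–Weil group of `X₁(11)` (Cremona, Table 1,
`N = 11`, A3: `r = 0`, `|T| = 5`), proved by the explicit `5`-descent of this series of files, the
Mordell–Weil theorem and reduction modulo `2` and `3`.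
[cite: Mazur1977, Ch. III §5 Cor. (5.3) p. 156 and Intro. Thm. (7); CremonaAlgorithms1997, Table 1, N = 11, curve A3] -/
theorem zmultiples_T_eq_top :
    AddSubgroup.zmultiples T = (⊤ : AddSubgroup curve11A3.toAffine.Point) :=
  zmultiples_T_eq_top_of_descent
    (fun hR _ hφ hnode => exists_rational_of_stableCoset hR hφ hnode)
    exists_sub_nsmul_T'_not_node

/-- **Billing–Mahler (1940)**: every rational solution of `y² + y = x³ - x²` has `y = 0` or
`y = -1`; equivalently the only rational points of `X₁(11)` are its five rational cusps.
[cite: BillingMahler1940, main theorem; Mazur1977, Ch. III §5 Cor. (5.3) p. 156] -/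
theorem billingMahler (x y : ℚ) (hE : y ^ 2 + y = x ^ 3 - x ^ 2) : y = 0 ∨ y = -1 :=
  billingMahler_of_descent
    (fun hR _ hφ hnode => exists_rational_of_stableCoset hR hφ hnode)
    exists_sub_nsmul_T'_not_node x y hE

end Literature.NumberTheory.EllipticCurves.X1Eleven

namespace Literature.NumberTheory.EllipticCurves

open Literature.NumberTheory.EllipticCurves.X1Eleven

/-- **Mazur's theorem at `N = 11`: no elliptic curve over `ℚ` — indeed no Weierstrass cubic over
`ℚ` — has a rational point of order `11`.** This is the case `p = 11` of
`Literature.NumberTheory.EllipticCurves.Mazur1977_no_prime_torsion W`, for every `W`, now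
proved: Billing–Mahler (`X1Eleven.billingMahler`, by the `5`-descent on `X₁(11)`) fed into the
tree's `Mazur1977_no_eleven_torsion_of_billingMahler` (Kubert's universal curve `E₁(11)`,
`KubertTateEleven`). Polymorphic in the `DecidableEq ℚ` instance carrying the group law.
[cite: Mazur1977, Intro. Thm. (7) p. 35 (m = 11) and Ch. III §5 Cor. (5.2)–(5.3) p. 156; BillingMahler1940, main theorem] -/
theorem Mazur1977_no_eleven_torsion [DecidableEq ℚ] (W : WeierstrassCurve ℚ) :
    ¬ ∃ P : W.toAffine.Point, addOrderOf P = 11 :=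
  Mazur1977_no_eleven_torsion_of_billingMahler billingMahler W

/-- The primes below `17`. [folklore] -/
theorem prime_lt_seventeen {p : ℕ} (hp : p.Prime) (h : p < 17) :
    p = 2 ∨ p = 3 ∨ p = 5 ∨ p = 7 ∨ p = 11 ∨ p = 13 := by
  interval_cases p
  · exact absurd hp Nat.not_prime_zero
  · exact absurd hp Nat.not_prime_one
  all_goals first
    | omega
    | exact absurd (hp.eq_one_or_self_of_dvd 2 (by decide)) (by omega)
    | exact absurd (hp.eq_one_or_self_of_dvd 3 (by decide)) (by omega)

/-- **What is left of the prime-case leaf.** With `N = 11` proved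
(`Mazur1977_no_eleven_torsion`), the named fact
`Literature.NumberTheory.EllipticCurves.Mazur1977_no_prime_torsion W` (Mazur 1977, Ch. III §5,
Cor. (5.2) for prime `N` with genus `X₀(N) > 0`, i.e. `N = 11` or `N ≥ 17`) follows, for a given
`W/ℚ`, from its cases `N ≥ 17` alone — the primes for which the printed proof (pp. 157–160:
Néron models, the Eisenstein quotient of `J₀(N)`) has no substitute in the tree.
[cite: Mazur1977, Ch. III §5, Cor. (5.2) and First reduction, p. 156] -/
theorem Mazur1977_no_prime_torsion_of_forall_seventeen_le (W : WeierstrassCurve ℚ)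
    (h : ∀ [W.IsElliptic] (p : ℕ), p.Prime → 17 ≤ p →
      ¬ ∃ P : W.toAffine.Point, addOrderOf P = p) :
    Mazur1977_no_prime_torsion W := by
  intro _ p hp hpS hex
  by_cases h17 : 17 ≤ p
  · exact h p hp h17 hex
  simp only [Finset.mem_insert, Finset.mem_singleton, not_or] at hpS
  obtain ⟨hp2, hp3, hp5, hp7, hp13⟩ := hpS
  rcases prime_lt_seventeen hp (not_le.mp h17) with rfl | rfl | rfl | rfl | rfl | rfl
  · exact hp2 rfl
  · exact hp3 rfl
  · exact hp5 rfl
  · exact hp7 rfl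
  · exact Mazur1977_no_eleven_torsion W hex
  · exact hp13 rfl

end Literature.NumberTheory.EllipticCurves

end
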